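import Summits.KontsevichZagierPeriods.Zeta5Search.RecordRayPhatDenominators
import HarnessLib

/-!
# The `P̂`-side denominator theorem with the TOP companion's dominating triple: a per-direction certificate
(cell `pub-zeta5`, seat ct-1 g46)

HONEST FRAMING: systematic search; no irrationality claim unless certified.  Integrality bookkeeping of the dictionary `ζ(3)`-numerator
`P̂(a) = ρ(UV′ − U′V)` (`XSave.PhatOf`) on Brown–Zudilin's residue-range box; nothing about the arithmetic nature of `ζ(5)`/`ζ(3)`; the
`P`-side is NOT touched; records in print UNMOVED; net named-fact debt 0.  Theorems only (0 `def`).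

OUR work (Summit side): `DescentPhatDenominatorsBox.two_mul_PhatOf_isInt` made ready-to-use.  Along the companions `κ ∈ [p₄, p₄+q₄]` of
(22) the eight integers (2.8) are `(κ, e₂, κ − c, e₄, e₅, e₆, e₇, e₈)` with `c = p₆ − q₃ + q₁ − p₂`… precisely
`(p₁+q₁−p₃+κ, p₃+q₃−p₀−p₆, p₂−q₁+q₃−p₆+κ, q₁+p₁−p₂, p₂+q₂−p₀, p₀, p₁+p₃+q₃−p₀−p₆−q₂, q₂+p₂−p₁)` — two of them increase with `κ`,
six are constant — so the list at the TOP companion `κ = p₄+q₄` dominates all of them entrywise (`companion_S_le_top`); the companions'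
Rhin–Viola parameters are non-negative as soon as `a` converges, `p ≥ 0`, `p₄+q₄ ≤ p₃` and the weight is non-zero (`p₆ ≤ κ`,
`le_of_w22_ne_zero`; `companion_nonneg`).  Hence:

* **`two_mul_lcm_top_PhatOf_isInt`** — for every `a` in the box of `rhs22_eq_on_box` (partner `j`) and every triple `(M,N,Q)` dominating
  (in Rhin–Viola's counting sense) the TOP list
  `[p₁+q₁−p₃+K, p₃+q₃−p₀−p₆, p₂−q₁+q₃−p₆+K, q₁+p₁−p₂, p₂+q₂−p₀, p₀, p₁+p₃+q₃−p₀−p₆−q₂, q₂+p₂−p₁]`, `K = p₄+q₄`: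
  **`2·d_M·d_N·d_Q·P̂(a) ∈ ℤ`** — a DECIDABLE per-direction certificate (for `a = n·a₀` the list is `n`·(the list of `a₀`), so one
  inspection of eight linear forms of `a₀` gives an all-`n` law; the record and flag rays of `RecordRayPhatDenominators` /
  `FlagRayPhatDenominators` sharpen it by Kummer's carry in the weights);
* `padicValRat_PhatOf_ge_of_top` — hence `v_p(P̂(a)) ≥ −(v_p(2) + v_p(d_M) + v_p(d_N) + v_p(d_Q))`, and **`no_prime_beyond_top`**: no ODD
  prime `p > max(M,N,Q)` divides the denominator of `P̂(a)`.
-/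

noncomputable section

open Finset

namespace Summit.KontsevichZagierPeriods.Zeta5Search.DescentPhatDenominatorsTop

open Literature.NumberTheory.Irrationality
open Literature.NumberTheory.Irrationality.BrownZudilin2022 (w22 pOf qOf bOfA Converges convergenceForms zchoose)
open Literature.NumberTheory.Irrationality.RhinViola2001 (Params d)
open Literature.NumberTheory.Irrationality.RhinViola2001.Theorem21 (Dom dom_mono)
open Summit.KontsevichZagierPeriods.Zeta5Search.WedgeDictionary (dOf)
open Summit.KontsevichZagierPeriods.Zeta5Search.XSave (PhatOf)
open Summit.KontsevichZagierPeriods.Zeta5Search.DescentPhatDenominatorsBox (companion_S two_mul_PhatOf_isInt)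
open Summit.KontsevichZagierPeriods.Zeta5Search.SymmetricPhatXSave (padicValNat_lcmUpto log_eq_zero_of_lt)
open Summit.KontsevichZagierPeriods.Zeta5Search.RecordRayPhatDenominators (neg_padicValNat_le_padicValRat)

/-! ### The companions below the top one -/

/-- A non-zero weight forces `p₆ ≤ κ` (the binomial `C(κ, p₆)` of `w_κ`). -/
theorem le_of_w22_ne_zero {p : Fin 7 → ℤ} {q : Fin 5 → ℤ} {κ : ℤ} (h : w22 p q κ ≠ 0) : p 6 ≤ κ := by
  by_contra hlt
  apply h
  unfold w22
  have : zchoose κ (p 6) = 0 := by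
    unfold zchoose
    rw [if_neg]
    omega
  rw [this]; ring

/-- The companions' Rhin–Viola parameters are non-negative on the box (convergence of `I(a)`, `p ≥ 0`, the residue range) once
`p₆ ≤ κ ≤ p₄ + q₄`. -/
theorem companion_nonneg (a : Fin 8 → ℤ) (hconv : Converges a) (hp : ∀ i, 0 ≤ pOf a i) (hres : pOf a 4 + qOf a 3 ≤ pOf a 3)
    {κ : ℤ} (h6 : pOf a 6 ≤ κ) (hK : κ ≤ pOf a 4 + qOf a 3) :
    (⟨pOf a 1, pOf a 3 - κ, pOf a 2, qOf a 0, pOf a 2 + (qOf a 2 - pOf a 6 + κ) - pOf a 0, qOf a 2 - pOf a 6 + κ,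
        pOf a 1 + (qOf a 2 - pOf a 6 + κ) - pOf a 0, qOf a 1⟩ : Params).Nonneg := by
  have c0 := hconv (a 0) (by simp [convergenceForms])
  have c1 := hconv (a 1) (by simp [convergenceForms])
  have c3 := hconv (a 3) (by simp [convergenceForms])
  have c4 := hconv (a 4) (by simp [convergenceForms])
  have c7 := hconv (a 0 + a 4 - a 2) (by simp [convergenceForms])
  have c13 := hconv (a 0 + a 7 - a 2) (by simp [convergenceForms])
  have c14 := hconv (a 0 + a 1 - a 3) (by simp [convergenceForms])
  have h1 := hp 1; have h2 := hp 2
  simp only [pOf, qOf, Matrix.cons_val] at h6 hK hres h1 h2 ⊢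
  refine ⟨?_, ?_, ?_, ?_, ?_, ?_, ?_, ?_⟩ <;> dsimp only <;> omega

/-- The (2.8)-list of the `κ`-th companion is entrywise below the TOP list (`κ ≤ K = p₄+q₄`). -/
theorem companion_S_le_top (p : Fin 7 → ℤ) (q : Fin 5 → ℤ) {κ : ℤ} (hK : κ ≤ p 4 + q 3) :
    List.Forall₂ (· ≤ ·)
      (⟨p 1, p 3 - κ, p 2, q 0, p 2 + (q 2 - p 6 + κ) - p 0, q 2 - p 6 + κ, p 1 + (q 2 - p 6 + κ) - p 0, q 1⟩ : Params).S
      [p 1 + q 0 - p 3 + (p 4 + q 3), p 3 + q 2 - p 0 - p 6, p 2 - q 0 + q 2 - p 6 + (p 4 + q 3), q 0 + p 1 - p 2,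
        p 2 + q 1 - p 0, p 0, p 1 + p 3 + q 2 - p 0 - p 6 - q 1, q 1 + p 2 - p 1] := by
  rw [companion_S]
  refine List.Forall₂.cons (by omega) (List.Forall₂.cons le_rfl (List.Forall₂.cons (by omega) (List.Forall₂.cons le_rfl
    (List.Forall₂.cons le_rfl (List.Forall₂.cons le_rfl (List.Forall₂.cons le_rfl (List.Forall₂.cons le_rfl
    List.Forall₂.nil)))))))

/-! ### The certificate -/

/-- **The top-companion certificate.**  For `a` in the box of `rhs22_eq_on_box` (partner `j`) and any triple `(M,N,Q)` dominating the
TOP list `[p₁+q₁−p₃+K, p₃+q₃−p₀−p₆, p₂−q₁+q₃−p₆+K, q₁+p₁−p₂, p₂+q₂−p₀, p₀, p₁+p₃+q₃−p₀−p₆−q₂, q₂+p₂−p₁]` (`K = p₄+q₄`) in the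
counting sense (no entry exceeds `M`, at most one exceeds `N`, at most two exceed `Q`): `2·d_M·d_N·d_Q·P̂(a) ∈ ℤ`. -/
theorem two_mul_lcm_top_PhatOf_isInt (a : Fin 8 → ℤ) (j : ℕ) (hj : j ∈ Icc 1 7) (hconv : Converges a)
    (hreg : ∀ i ∈ Icc 1 7, 0 ≤ bOfA a i ∧ 2 * bOfA a i ≤ bOfA a 0 + 1) (hd : 0 ≤ dOf (bOfA a))
    (hpart : 2 * (bOfA a j + 1) ≤ bOfA a 0 + 1) (h2b : ∀ i ∈ Icc 1 7, 2 * bOfA a i ≤ bOfA a 0)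
    (hp : ∀ i, 0 ≤ pOf a i) (hres : pOf a 4 + qOf a 3 ≤ pOf a 3)
    (hcl2 : bOfA a 0 - bOfA a 1 - bOfA a 2 ≤ dOf (bOfA a) + max 0 (max (bOfA a 7 - bOfA a 1) (bOfA a 7 - bOfA a 2)))
    (M N Q : ℤ)
    (hDom : Dom [pOf a 1 + qOf a 0 - pOf a 3 + (pOf a 4 + qOf a 3), pOf a 3 + qOf a 2 - pOf a 0 - pOf a 6,
      pOf a 2 - qOf a 0 + qOf a 2 - pOf a 6 + (pOf a 4 + qOf a 3), qOf a 0 + pOf a 1 - pOf a 2, pOf a 2 + qOf a 1 - pOf a 0, pOf a 0,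
      pOf a 1 + pOf a 3 + qOf a 2 - pOf a 0 - pOf a 6 - qOf a 1, qOf a 1 + pOf a 2 - pOf a 1] M N Q) :
    ∃ z : ℤ, (z : ℚ) = 2 * ((d M * d N * d Q : ℕ) : ℚ) * PhatOf a j := by
  refine two_mul_PhatOf_isInt a j hj hconv hreg hd hpart h2b hp hres hcl2 (d M * d N * d Q) fun κ hκ hw => ?_
  rw [mem_Icc] at hκ
  exact ⟨M, N, Q, companion_nonneg a hconv hp hres (le_of_w22_ne_zero hw) hκ.2,
    dom_mono (companion_S_le_top (pOf a) (qOf a) hκ.2) hDom, dvd_mul_right _ _⟩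

/-- Hence `v_p(P̂(a)) ≥ −(v_p(2) + v_p(d_M) + v_p(d_N) + v_p(d_Q))` (every prime). -/
theorem padicValRat_PhatOf_ge_of_top {p : ℕ} [hp' : Fact p.Prime] (a : Fin 8 → ℤ) (j : ℕ) (hj : j ∈ Icc 1 7)
    (hconv : Converges a) (hreg : ∀ i ∈ Icc 1 7, 0 ≤ bOfA a i ∧ 2 * bOfA a i ≤ bOfA a 0 + 1) (hd : 0 ≤ dOf (bOfA a))
    (hpart : 2 * (bOfA a j + 1) ≤ bOfA a 0 + 1) (h2b : ∀ i ∈ Icc 1 7, 2 * bOfA a i ≤ bOfA a 0)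
    (hp : ∀ i, 0 ≤ pOf a i) (hres : pOf a 4 + qOf a 3 ≤ pOf a 3)
    (hcl2 : bOfA a 0 - bOfA a 1 - bOfA a 2 ≤ dOf (bOfA a) + max 0 (max (bOfA a 7 - bOfA a 1) (bOfA a 7 - bOfA a 2)))
    (M N Q : ℤ)
    (hDom : Dom [pOf a 1 + qOf a 0 - pOf a 3 + (pOf a 4 + qOf a 3), pOf a 3 + qOf a 2 - pOf a 0 - pOf a 6,
      pOf a 2 - qOf a 0 + qOf a 2 - pOf a 6 + (pOf a 4 + qOf a 3), qOf a 0 + pOf a 1 - pOf a 2, pOf a 2 + qOf a 1 - pOf a 0, pOf a 0,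
      pOf a 1 + pOf a 3 + qOf a 2 - pOf a 0 - pOf a 6 - qOf a 1, qOf a 1 + pOf a 2 - pOf a 1] M N Q) :
    -((padicValNat p 2 + Nat.log p M.toNat + Nat.log p N.toNat + Nat.log p Q.toNat : ℕ) : ℤ) ≤ padicValRat p (PhatOf a j) := by
  have hD : 2 * (d M * d N * d Q) ≠ 0 :=
    mul_ne_zero two_ne_zero (mul_ne_zero (mul_ne_zero (Nat.lcmUpto_ne_zero _) (Nat.lcmUpto_ne_zero _)) (Nat.lcmUpto_ne_zero _))
  have h := neg_padicValNat_le_padicValRat (p := p) hD (X := PhatOf a j) (by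
    obtain ⟨z, hz⟩ := two_mul_lcm_top_PhatOf_isInt a j hj hconv hreg hd hpart h2b hp hres hcl2 M N Q hDom
    exact ⟨z, by rw [hz]; push_cast; ring⟩)
  simp only [d] at h
  rw [padicValNat.mul two_ne_zero (mul_ne_zero (mul_ne_zero (Nat.lcmUpto_ne_zero _) (Nat.lcmUpto_ne_zero _))
      (Nat.lcmUpto_ne_zero _)), padicValNat.mul (mul_ne_zero (Nat.lcmUpto_ne_zero _) (Nat.lcmUpto_ne_zero _))
      (Nat.lcmUpto_ne_zero _), padicValNat.mul (Nat.lcmUpto_ne_zero _) (Nat.lcmUpto_ne_zero _),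
    padicValNat_lcmUpto hp'.out, padicValNat_lcmUpto hp'.out, padicValNat_lcmUpto hp'.out] at h
  push_cast at h ⊢
  linarith

/-- **No odd prime beyond the top list divides the denominator of `P̂(a)`**: for `a` in the box, `(M,N,Q)` dominating the top list,
and an odd prime `p > max(M,N,Q)`: `v_p(P̂(a)) ≥ 0`. -/
theorem no_prime_beyond_top {p : ℕ} (hp' : p.Prime) (hp2 : p ≠ 2) (a : Fin 8 → ℤ) (j : ℕ) (hj : j ∈ Icc 1 7)
    (hconv : Converges a) (hreg : ∀ i ∈ Icc 1 7, 0 ≤ bOfA a i ∧ 2 * bOfA a i ≤ bOfA a 0 + 1) (hd : 0 ≤ dOf (bOfA a))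
    (hpart : 2 * (bOfA a j + 1) ≤ bOfA a 0 + 1) (h2b : ∀ i ∈ Icc 1 7, 2 * bOfA a i ≤ bOfA a 0)
    (hp : ∀ i, 0 ≤ pOf a i) (hres : pOf a 4 + qOf a 3 ≤ pOf a 3)
    (hcl2 : bOfA a 0 - bOfA a 1 - bOfA a 2 ≤ dOf (bOfA a) + max 0 (max (bOfA a 7 - bOfA a 1) (bOfA a 7 - bOfA a 2)))
    (M N Q : ℤ)
    (hDom : Dom [pOf a 1 + qOf a 0 - pOf a 3 + (pOf a 4 + qOf a 3), pOf a 3 + qOf a 2 - pOf a 0 - pOf a 6,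
      pOf a 2 - qOf a 0 + qOf a 2 - pOf a 6 + (pOf a 4 + qOf a 3), qOf a 0 + pOf a 1 - pOf a 2, pOf a 2 + qOf a 1 - pOf a 0, pOf a 0,
      pOf a 1 + pOf a 3 + qOf a 2 - pOf a 0 - pOf a 6 - qOf a 1, qOf a 1 + pOf a 2 - pOf a 1] M N Q)
    (hM : M < p) (hN : N < p) (hQ : Q < p) : 0 ≤ padicValRat p (PhatOf a j) := by
  haveI : Fact p.Prime := ⟨hp'⟩
  have hp2' : 2 ≤ p := hp'.two_le
  have h := padicValRat_PhatOf_ge_of_top (p := p) a j hj hconv hreg hd hpart h2b hp hres hcl2 M N Q hDom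
  rw [log_eq_zero_of_lt (by omega : M.toNat < p), log_eq_zero_of_lt (by omega : N.toNat < p),
    log_eq_zero_of_lt (by omega : Q.toNat < p),
    padicValNat.eq_zero_of_not_dvd (show ¬ p ∣ 2 from fun h2 => hp2 ((Nat.prime_dvd_prime_iff_eq hp' Nat.prime_two).1 h2))]
    at h
  simpa using h

end Summit.KontsevichZagierPeriods.Zeta5Search.DescentPhatDenominatorsTop
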